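import Summits.CriticalPhenomena.PercolationContinuityZ3.Theorems.Transplant.KNCellsScheme
import HarnessLib

/-!
# v3′ — the ENTRY-SEED STAR scheme (generic layer, part 1): star geometries, pattern connectivity, the entry / star events, the staged
# probe of one macro-edge and its locality, the replayed state, success, validity and the scheme
# (design of record: HOME/ENTRY-SEED-STAR.md (lead V51) + HOME/prim-bschramm-p2-g2/KIT3-SIGNATURE.md; replaces Kozma–Nitzan's stubs/(30)–(37)
# by an entry seed and a fresh star per examined macro-vertex, for graphs like `X □ ℤ²` where the lag-1 hand-over cannot be discharged)

builds on p205010 (kernel theorem, internal audit signed; external expert review pending) — nothing in this file uses p205010.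
Lane `prim-bschramm`, seat `prim-bschramm-p2` (generic v3′, lead arbitration 12:43Z); helper file (`--supports stmt-CriticalPhenomena-4575`).

THE SCHEME.  A macro-vertex `y` is examined along the macro-edge `(x → y)` from an occupied `x` (anchor `γ_x`, entry vertex `u*_x`, star
pattern `P_x`): the `N` ENTRY EDGES `s(u_i, into u_i δ)` from the pinned strip vertices `u_i` of the arrival slab `A^{γ_x}_{x,δ}` (joined to
`u*_x` inside `Star_x` by `P_x`) into the fresh core of `y` are revealed; if one is open (`i*` least), `u*_y := into u_{i*} δ`,
`γ_y := fib u*_y`, and the fresh STAR `Star γ_y y ons = K ∪ ⋃_{δ' onward} (Corr ∪ A)` is revealed; `y` is OCCUPIED iff some entry edge is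
open AND `u*_y` is joined inside the star, by the observed open edges, to every strip of every onward arrival slab.  One adaptive probe per
macro-edge (the star part of the reveal depends on the entry pattern), fitting `HSiteScheme` verbatim.
* §1 `StarGeom V A` (N, root, a₀, fib, col, K, Corr, Aslab, strip, into), `Star`; `KSch₃`;
* §2 pattern connectivity `PConn F u t` (reachability in the graph of the edge set `F`), `stripPt` (a strip vertex joined to the source in a
  pattern, by choice), locality in the pattern;
* §3 the replayed state `SState` (macro-state, anchors, entry vertices, star patterns, onward sets) and the data of the probe after a history:
  `entryV/entryE/candA/onward₃/starOf/env₃/entryIdx/revealOf₃/succ₃` and their locality; the probe `probe₃ : AProbe V`;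
The replay / validity / scheme are part 2 (`KNStarProcess`).  No geometric axiom is assumed here; the later parts take the named facts they use.
[cite: KozmaNitzan2024, §4 pp. 25–27 (exploration processes; (1)–(5))] [cite: GrimmettPercolation1999, §7.2]
-/

noncomputable section

open MeasureTheory ProbabilityTheory
open scoped ENNReal Classical

namespace Summit.CriticalPhenomena.PercolationContinuityZ3.Theorems

namespace Transplant

namespace KNStar

open Literature.Probability.Percolation Literature.Probability.LatticeModels SimpleGraph GadgetSystem ProbeHistory HSiteScheme
open KNCells (vspan mem_vspan_iff)
open Literature.Probability.Percolation.KozmaNitzan (opens)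

variable {V : Type*} [DecidableEq V]

/-! ## §1 Star geometries -/

/-- **Star geometry** on the vertex type `V` with anchor type `A`: `N` strips per arrival slab; the root and its anchor; the fibre
coordinate; the column marker of a macro-vertex; the core `K γ v`, the corridor `Corr γ v δ` towards `v + δ` and the arrival slab
`Aslab γ v δ` of the cell `v + δ` on its `(-δ)`-side, all anchored at `γ`; the strips of an arrival slab; the unit step `into u δ` across
the slab's inner face. [cite: KozmaNitzan2024, §4 pp. 25–26 (cells Q_v, E_{v,x})] -/
structure StarGeom (V A : Type*) where
  /-- number of strips / entry edges -/
  N : ℕ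
  /-- the root vertex -/
  root : V
  /-- the root anchor -/
  a₀ : A
  /-- the fibre coordinate of a vertex -/
  fib : V → A
  /-- the column marker of a macro-vertex -/
  col : Site 2 → Finset V
  /-- the core of the cell of `v`, anchored -/
  K : A → Site 2 → Finset V
  /-- the corridor from the cell of `v` towards `v + δ`, anchored -/
  Corr : A → Site 2 → MDir → Finset V
  /-- the arrival slab of the cell `v + δ` on the side of `v`, anchored -/
  Aslab : A → Site 2 → MDir → Finset V
  /-- the strips of the arrival slab -/
  strip : A → Site 2 → MDir → Fin N → Finset V
  /-- the unit step across the inner face of an arrival slab -/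
  into : V → MDir → V

namespace StarGeom

variable {A : Type*} (Γ : StarGeom V A)

/-- **The star** of the cell of `v` anchored at `γ` with onward directions `ons`: core, onward corridors and the arrival slabs of the onward
cells. [cite: KozmaNitzan2024, §4 p. 26 (E_{v,x})] -/
def Star (γ : A) (v : Site 2) (ons : Finset MDir) : Finset V :=
  Γ.K γ v ∪ ons.biUnion fun δ => Γ.Corr γ v δ ∪ Γ.Aslab γ v δ

/-- The core lies in the star. [folklore] -/
theorem K_subset_Star (γ : A) (v : Site 2) (ons : Finset MDir) : Γ.K γ v ⊆ Γ.Star γ v ons := Finset.subset_union_left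

/-- An onward arrival slab lies in the star. [folklore] -/
theorem Aslab_subset_Star {γ : A} {v : Site 2} {ons : Finset MDir} {δ : MDir} (hδ : δ ∈ ons) :
    Γ.Aslab γ v δ ⊆ Γ.Star γ v ons := fun _ hy =>
  Finset.mem_union_right _ (Finset.mem_biUnion.2 ⟨δ, hδ, Finset.mem_union_right _ hy⟩)

/-- An onward corridor lies in the star. [folklore] -/
theorem Corr_subset_Star {γ : A} {v : Site 2} {ons : Finset MDir} {δ : MDir} (hδ : δ ∈ ons) :
    Γ.Corr γ v δ ⊆ Γ.Star γ v ons := fun _ hy =>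
  Finset.mem_union_right _ (Finset.mem_biUnion.2 ⟨δ, hδ, Finset.mem_union_left _ hy⟩)

end StarGeom

/-- **The scheme data**: a star geometry and the density `p` (for statements). [cite: KozmaNitzan2024, §4 p. 25] -/
structure KSch₃ (V A : Type*) where
  /-- the star geometry -/
  Γ : StarGeom V A
  /-- the density -/
  p : unitInterval

/-! ## §2 Connectivity inside a pattern -/

/-- **`u` is joined to `t` by the edges of the finite edge set `F`** (reachability in `fromEdgeSet F`). [folklore] -/
def PConn (F : Finset (Sym2 V)) (u t : V) : Prop := (SimpleGraph.fromEdgeSet (↑F : Set (Sym2 V))).Reachable u t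

omit [DecidableEq V] in
/-- `PConn` is reflexive. [folklore] -/
theorem PConn.refl (F : Finset (Sym2 V)) (u : V) : PConn F u u := SimpleGraph.Reachable.refl _

omit [DecidableEq V] in
/-- `PConn` is monotone in the edge set. [folklore] -/
theorem PConn.mono {F F' : Finset (Sym2 V)} (h : F ⊆ F') {u t : V} (huv : PConn F u t) : PConn F' u t :=
  SimpleGraph.Reachable.mono (SimpleGraph.fromEdgeSet_mono (Finset.coe_subset.2 h)) huv

omit [DecidableEq V] in
/-- `PConn` is transitive. [folklore] -/
theorem PConn.trans {F : Finset (Sym2 V)} {u t w : V} (h1 : PConn F u t) (h2 : PConn F t w) : PConn F u w :=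
  SimpleGraph.Reachable.trans h1 h2

omit [DecidableEq V] in
/-- An edge of the pattern joins its endpoints. [folklore] -/
theorem PConn.of_mem {F : Finset (Sym2 V)} {u t : V} (hne : u ≠ t) (h : s(u, t) ∈ F) : PConn F u t :=
  SimpleGraph.Adj.reachable ((SimpleGraph.fromEdgeSet_adj _).2 ⟨Finset.mem_coe.2 h, hne⟩)

namespace StarGeom

variable {A : Type*} (Γ : StarGeom V A)

/-- **The pinned strip vertex**: a vertex of the strip `i` of the arrival slab towards `δ` joined to the source `u` by the pattern `F`
(by choice; `u` itself if there is none). [cite: KozmaNitzan2024, §4 p. 27 (the examined data are functions of the observation)] -/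
def stripPt (γ : A) (v : Site 2) (δ : MDir) (i : Fin Γ.N) (u : V) (F : Finset (Sym2 V)) : V :=
  if h : ∃ t ∈ Γ.strip γ v δ i, PConn F u t then Classical.choose h else u

omit [DecidableEq V] in
/-- If some strip vertex is joined to the source, the pinned strip vertex is one. [folklore] -/
theorem stripPt_spec {γ : A} {v : Site 2} {δ : MDir} {i : Fin Γ.N} {u : V} {F : Finset (Sym2 V)}
    (h : ∃ t ∈ Γ.strip γ v δ i, PConn F u t) :
    Γ.stripPt γ v δ i u F ∈ Γ.strip γ v δ i ∧ PConn F u (Γ.stripPt γ v δ i u F) := by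
  unfold stripPt; rw [dif_pos h]; exact Classical.choose_spec h

end StarGeom

/-! ## §3 The replayed state and the probe after a history -/

/-- **The replayed state**: the macro-state, and for every macro-vertex its anchor, its entry vertex, the open pattern of its star and its
onward directions (junk off the occupied ones). [cite: KozmaNitzan2024, §4 pp. 25–27] -/
structure SState (V A : Type*) where
  /-- the macro-state (occupied / blocked) -/
  st : HSiteScheme.HState
  /-- anchors -/
  anc : Site 2 → A
  /-- entry vertices -/
  src : Site 2 → V
  /-- open patterns of the stars -/
  pat : Site 2 → Finset (Sym2 V)
  /-- onward directions at examination -/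
  ons : Site 2 → Finset MDir

namespace KSch₃

variable {A : Type*} (G : SimpleGraph V) [G.LocallyFinite] (S : KSch₃ V A)

/-- The initial edges: none are required (the root's star is examined by the first probe… no: the root is occupied from the start, its star
must be pinned) — we require the edges of `G` inside the root star to be open: `U₀ = edgesIn (Star a₀ 0 univ)`.
[cite: KozmaNitzan2024, §4 p. 27 (G₀ = {0} if all edges of Q_0 are open)] -/
def U₀ : Finset (Sym2 V) := edgesIn G (S.Γ.Star S.Γ.a₀ 0 Finset.univ)

/-- The explored edges after a history. [cite: KozmaNitzan2024, §4 p. 26 (ω|_{E_i})] -/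
def F (h : ProbeHistory V) : Finset (Sym2 V) := S.U₀ G ∪ supp h

/-- The explored region. [cite: KozmaNitzan2024, §4 p. 26 (E_i)] -/
def Vx (h : ProbeHistory V) : Finset V := vspan (S.F G h)

/-- The onward directions out of `v`: the neighbours whose column is unexplored. [cite: KozmaNitzan2024, §4 p. 26 ((29))] -/
def onward₃ (h : ProbeHistory V) (v : Site 2) : Finset MDir :=
  Finset.univ.filter fun du => ∀ y ∈ S.Vx G h, y ∉ S.Γ.col (v + stepVec du)

/-- The initial replayed state: the root occupied with anchor `a₀`, entry vertex `root`, pattern `U₀` (all open), all directions onward.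
[cite: KozmaNitzan2024, §4 p. 25 (1)] -/
def sInit : SState V A :=
  ⟨HSiteScheme.HState.start, fun _ => S.Γ.a₀, fun _ => S.Γ.root, fun _ => S.U₀ G, fun _ => Finset.univ⟩

variable {G S}

section ProbeData

variable (S)

/-- The pinned strip vertices of the source `x = e.1` towards `e.2`. [cite: KozmaNitzan2024, §4 p. 27] -/
def entryV (σ : SState V A) (e : Site 2 × MDir) (i : Fin S.Γ.N) : V := S.Γ.stripPt (σ.anc e.1) e.1 e.2 i (σ.src e.1) (σ.pat e.1)

/-- The candidate entry vertices of the target. [folklore] -/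
def candU (σ : SState V A) (e : Site 2 × MDir) (i : Fin S.Γ.N) : V := S.Γ.into (S.entryV σ e i) e.2

/-- The entry edges. [cite: KozmaNitzan2024, §4 p. 27] -/
def entryE (σ : SState V A) (e : Site 2 × MDir) (i : Fin S.Γ.N) : Sym2 V := s(S.entryV σ e i, S.candU σ e i)

/-- The candidate anchors of the target. [folklore] -/
def candA (σ : SState V A) (e : Site 2 × MDir) (i : Fin S.Γ.N) : A := S.Γ.fib (S.candU σ e i)

/-- The set of entry edges. [folklore] -/
def entrySet (σ : SState V A) (e : Site 2 × MDir) : Finset (Sym2 V) := Finset.univ.image (S.entryE σ e)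

/-- **The index of the first open entry edge** in an observation, if any. [folklore] -/
def entryIdx (σ : SState V A) (e : Site 2 × MDir) (o : Finset (Sym2 V)) : Option (Fin S.Γ.N) :=
  (Finset.univ.filter fun i => S.entryE σ e i ∈ o).min

variable (G)

/-- The candidate stars of the target. [folklore] -/
def starOf (σ : SState V A) (h : ProbeHistory V) (e : Site 2 × MDir) (i : Fin S.Γ.N) : Finset V :=
  S.Γ.Star (S.candA σ e i) (tgt e) (S.onward₃ G h (tgt e))

/-- **The envelope**: the entry edges and the edges of all candidate stars. [cite: KozmaNitzan2024, §4 p. 25 (2)] -/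
def env₃ (σ : SState V A) (h : ProbeHistory V) (e : Site 2 × MDir) : Finset (Sym2 V) :=
  S.entrySet σ e ∪ Finset.univ.biUnion fun i => edgesIn G (S.starOf G σ h e i)

/-- The revealed edges as a function of the observation: the entry edges, and the chosen star if some entry edge is open.
[cite: KozmaNitzan2024, §4 p. 27 (adaptive examination)] -/
def revealOf₃ (σ : SState V A) (h : ProbeHistory V) (e : Site 2 × MDir) (o : Finset (Sym2 V)) : Finset (Sym2 V) :=
  S.entrySet σ e ∪ match S.entryIdx σ e o with
    | none => ∅
    | some i => edgesIn G (S.starOf G σ h e i)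

/-- **Success**: some entry edge is open, and the entry vertex is joined, by the observed open edges of the chosen star, to every strip of
every onward arrival slab. [cite: KozmaNitzan2024, §4 p. 27 ("declare v good …")] -/
def succ₃ (σ : SState V A) (h : ProbeHistory V) (e : Site 2 × MDir) (o : Finset (Sym2 V)) : Prop :=
  ∃ i, S.entryIdx σ e o = some i ∧ ∀ δ ∈ S.onward₃ G h (tgt e), ∀ j : Fin S.Γ.N,
    ∃ t ∈ S.Γ.strip (S.candA σ e i) (tgt e) δ j, PConn (o ∩ edgesIn G (S.starOf G σ h e i)) (S.candU σ e i) t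

/-! ### Locality -/

variable {G S}
variable {σ : SState V A} {h : ProbeHistory V} {e : Site 2 × MDir}

omit [G.LocallyFinite] in
/-- The entry index depends only on the entry edges' status. [folklore] -/
theorem entryIdx_congr {o o' : Finset (Sym2 V)} (hag : ∀ x ∈ S.entrySet σ e, x ∈ o ↔ x ∈ o') :
    S.entryIdx σ e o = S.entryIdx σ e o' := by
  unfold entryIdx
  congr 1
  ext i
  simp only [Finset.mem_filter, Finset.mem_univ, true_and]
  exact hag _ (Finset.mem_image.2 ⟨i, Finset.mem_univ _, rfl⟩)

/-- The entry edges are revealed. [folklore] -/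
theorem entrySet_subset_revealOf₃ (o : Finset (Sym2 V)) : S.entrySet σ e ⊆ S.revealOf₃ G σ h e o := Finset.subset_union_left

/-- If entry edge `i` is the first open one, the star `i` is revealed. [folklore] -/
theorem star_subset_revealOf₃ {o : Finset (Sym2 V)} {i : Fin S.Γ.N} (hi : S.entryIdx σ e o = some i) :
    edgesIn G (S.starOf G σ h e i) ⊆ S.revealOf₃ G σ h e o := by
  intro x hx; unfold revealOf₃; rw [hi]; exact Finset.mem_union_right _ hx

/-- The revealed edges lie in the envelope. [folklore] -/
theorem revealOf₃_subset_env (o : Finset (Sym2 V)) : S.revealOf₃ G σ h e o ⊆ S.env₃ G σ h e := by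
  intro x hx
  unfold revealOf₃ at hx
  rcases Finset.mem_union.1 hx with hx | hx
  · exact Finset.mem_union_left _ hx
  · cases hi : S.entryIdx σ e o with
    | none => rw [hi] at hx; simp at hx
    | some i => rw [hi] at hx; exact Finset.mem_union_right _ (Finset.mem_biUnion.2 ⟨i, Finset.mem_univ _, hx⟩)

/-- **Locality of the reveal**: observations agreeing on the revealed edges reveal the same edges. [folklore] -/
theorem revealOf₃_congr {o o' : Finset (Sym2 V)} (hag : ∀ x ∈ S.revealOf₃ G σ h e o, x ∈ o ↔ x ∈ o') :
    S.revealOf₃ G σ h e o' = S.revealOf₃ G σ h e o := by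
  have hidx : S.entryIdx σ e o' = S.entryIdx σ e o :=
    (entryIdx_congr fun x hx => hag x (entrySet_subset_revealOf₃ o hx)).symm
  unfold revealOf₃; rw [hidx]

/-- The pattern on the chosen star is the same for observations agreeing on the revealed edges. [folklore] -/
theorem inter_star_congr {o o' : Finset (Sym2 V)} (hag : ∀ x ∈ S.revealOf₃ G σ h e o, x ∈ o ↔ x ∈ o') {i : Fin S.Γ.N}
    (hi : S.entryIdx σ e o = some i) : o ∩ edgesIn G (S.starOf G σ h e i) = o' ∩ edgesIn G (S.starOf G σ h e i) := by
  ext x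
  simp only [Finset.mem_inter]
  constructor
  · rintro ⟨hxo, hxS⟩; exact ⟨(hag x (star_subset_revealOf₃ hi hxS)).1 hxo, hxS⟩
  · rintro ⟨hxo, hxS⟩; exact ⟨(hag x (star_subset_revealOf₃ hi hxS)).2 hxo, hxS⟩

/-- **Locality of success**: observations agreeing on the revealed edges have the same success. [folklore] -/
theorem succ₃_congr {o o' : Finset (Sym2 V)} (hag : ∀ x ∈ S.revealOf₃ G σ h e o, x ∈ o ↔ x ∈ o') :
    S.succ₃ G σ h e o ↔ S.succ₃ G σ h e o' := by
  have hidx : S.entryIdx σ e o' = S.entryIdx σ e o :=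
    (entryIdx_congr fun x hx => hag x (entrySet_subset_revealOf₃ o hx)).symm
  unfold succ₃
  constructor
  · rintro ⟨i, hi, hall⟩
    refine ⟨i, hidx.trans hi, fun δ hδ j => ?_⟩
    obtain ⟨t, ht, hc⟩ := hall δ hδ j
    exact ⟨t, ht, by rwa [← inter_star_congr hag hi]⟩
  · rintro ⟨i, hi, hall⟩
    have hi' : S.entryIdx σ e o = some i := hidx.symm.trans hi
    refine ⟨i, hi', fun δ hδ j => ?_⟩
    obtain ⟨t, ht, hc⟩ := hall δ hδ j
    exact ⟨t, ht, by rwa [inter_star_congr hag hi']⟩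

variable (G S σ h e)

/-- **The staged probe** of the examination along `e` from the replayed state `σ`. [cite: KozmaNitzan2024, §4 p. 27] -/
def probe₃ : AProbe V where
  env := S.env₃ G σ h e
  reveal := fun ω => S.revealOf₃ G σ h e (obs ω (S.env₃ G σ h e))
  reveal_subset := fun ω => revealOf₃_subset_env _
  reveal_local := by
    intro ω ω' hag
    refine revealOf₃_congr fun x hx => ?_
    have hxe : x ∈ S.env₃ G σ h e := revealOf₃_subset_env _ hx
    simp only [mem_obs_iff, hxe, true_and]
    exact hag x hx

/-- Success read off the probe's observation is success read off the envelope's observation. [folklore] -/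
theorem succ₃_read_iff (ω : BondConfig V) :
    S.succ₃ G σ h e ((S.probe₃ G σ h e).read ω) ↔ S.succ₃ G σ h e (obs ω (S.env₃ G σ h e)) := by
  refine (succ₃_congr (o := obs ω (S.env₃ G σ h e)) fun x hx => ?_).symm
  have hxe : x ∈ S.env₃ G σ h e := revealOf₃_subset_env _ hx
  simp only [AProbe.read, probe₃, mem_obs_iff, hxe, hx, true_and]

end ProbeData

end KSch₃

end KNStar

end Transplant

end Summit.CriticalPhenomena.PercolationContinuityZ3.Theorems

end
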